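import Summits.HodgeConjecture.HodgeConjecture.Theorems.F0P3StubS5Holds   -- ★ `stubS5_holds` (h2 edition) ← ★ `F0P3StubS5OfLetters` ← ★ `F0P3StubS5Fold` (`stubS5_of`, `exists_ne_zero_containsForm_of_classes`, `two_le_finrank_maximalRealSubfield`) + ★ `H413CohFormsL2`
import Summits.HodgeConjecture.HodgeConjecture.Theorems.F0P3ThreadLetters3Defs        -- ★ (S5-R20 (a)) the TWO-COMPACT-PLACE letter texts BY NAME: `StubE1coh₃`, `CohFinComponentUniqueHol₃∕Antihol₃`, `HodgeTypeRigid₃` (+ monotones, conjugation)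
import Summits.HodgeConjecture.HodgeConjecture.Theorems.R90ThreeLeFinrankRealSubfieldOfSixLe   -- ★ p862329 `R90.three_le_finrank_maximalRealSubfield_of_six_le` (`h3` from `h6`; director s2043 (iii))
import HarnessLib

/-!
# Crux `H413` — the S5 FOLD (Hodge-type exclusion at the pin), TWO-COMPACT-PLACE TWIN (R90-TF THREAD-₃ link (7c)): `stubS5_of₃` ∕ `stubS5_of_spectralProjection₃` ∕ `stubS5_holds₃`

Cell hodgecm-mathlib, crux item H413 = stmt-HodgeConjecture-24833; R90-TF slab S5 seat R90-C133-p01 (g2), deal (H21); S5 dealer R90-C133-plan (g3) RULING S5-R20 «ONE TEXT HOME, TWO LANES»; heir LEAD F0P3a-plan (g22) RULING (R-44) (C)(7) «S5 LOAN»; director (g40) s2043 (c)(ii)(iii); RULING S5-R19 «₃ twins live Summits-side»; census `R90/R90-C133-p01/g2/CENSUS-L7.md`.  PROOF lane (theorems only; no `def`, no instance, no notation, no `sorry`); ADDITIVE (new module; the ★ original is untouched and imported for its opens and lemmas); `--supports stmt-HodgeConjecture-24833 --as helper`.  HONEST LABEL: this file pays nothing; HC_CM is proved only modulo the 7 printed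 citations (2 remaining named inputs: hLiu418 = stmt-HodgeConjecture-24832, h413 = stmt-HodgeConjecture-24833) until rung 0 closes.

WHAT CHANGES w.r.t. the ★ files `F0P3StubS5Fold` ∕ `F0P3StubS5OfLetters` ∕ `F0P3StubS5Holds` (everything else VERBATIM): the ONE engine letter the S5 fold consumes, E2′, is taken BY
NAME in its two-compact-place edition `(hE2' : HodgeTypeRigid₃)` (★ `F0P3ThreadLetters3Defs`: Literature `hodgeTypeRigid` body + ONE `3 ≤ [L⁺:ℚ]` line); `h3 : 3 ≤ [K⁺:ℚ]` is
derived beside `h2` by ★ `R90.three_le_finrank_maximalRealSubfield_of_six_le (K F) h6` and passed at the ONE application of E2′ (★ `stubS5_of` :178); the TP⁺ ∕ detection letters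
and `hcont` keep their `h2` texts ((D)hol ∕ (D)antihol ★-proved, by name in `stubS5_holds₃`).  CONCLUSION = ★ `stubS5_holds`'s VERBATIM (quantifies over `(hDel, F, h6, V, a₀, Φ, i)`).
PRINT-FAITHFULNESS (director s2043 (iii)): «`3 ≤ [F⁺:ℚ]` is implied by Hyp413 (`6 ≤ [F:ℚ]`); the weakening costs nothing at the summit; anchor [Rogawski1990 §13.3 (13.3.6(c)), two compact places]» — the `3 ≤` clause is a ROUTE restriction of the R90-TF road (Arthur-simple trace formula: two compact real places), not Rogawski's hypothesis.
References: as in ★ `F0P3StubS5Fold` ([Rogawski1990] Thm. 13.3.6 (c), §15.3 ¶1, §12.3 p. 174, Thm. 14.6.4, Thm. 13.3.5; [BorelJacquet1979] §4.6; [Liu2021] proof of Prop. 4.13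
l. 2140–2146, Lem. D.2 (2); [Borel1997] Thm. 2.13, §8.4).
-/

set_option linter.dupNamespace false

noncomputable section

namespace Summit.HodgeConjecture.HodgeConjecture.Cruxes.H413.F0P3StubS5Fold3

open scoped TensorProduct Matrix InnerProductSpace ENNReal ComplexOrder
open MeasureTheory
open NumberField NumberField.InfinitePlace IsDedekindDomain
open HodgeCM.Model HodgeCM.Model.LiuIndex HodgeCM.Model.TowerCarrier
open Summit.HodgeConjecture.CorCM.Model
open Literature.AlgebraicGeometry.Motives (CMType AbelianVariety)
open Literature.AlgebraicGeometry.HodgeTheory Literature.NumberTheory.Automorphic.PicardCM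
open Literature.AlgebraicGeometry.ShimuraVarieties Literature.AlgebraicGeometry.ShimuraVarieties.UnitaryCanonicalModel
open Literature.NumberTheory.ComplexMultiplication
open Literature.NumberTheory.Automorphic
open Literature.NumberTheory.Automorphic.Liu2021 Literature.NumberTheory.Automorphic.Liu2021.AppendixC
open Literature.NumberTheory.Automorphic.Liu2021.Def411WeilCarriers (lineOf locF Rep)
open Summit.HodgeConjecture.CorCM.Transposition.OmegaTransport (realUnit)
open HodgeCM.Model.ArchSideTerm (e₁)
open Literature.NumberTheory.GelbartRogawski1991 Literature.NumberTheory.GelbartRogawski1991.UnitaryDualPair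
open Literature.RepresentationTheory Literature.RepresentationTheory.Liu2021
open Summit.HodgeConjecture.CorCM
open Summit.HodgeConjecture.CorCM.Transposition
open Literature.NumberTheory.GelbartRogawski1991.OscillatorTripleDictionary (OccursInH1 IsIsoToOmega)
open Summit.HodgeConjecture.HodgeConjecture.Theses (HCCMUnconditional.HDel)
open MulAction
open Literature.Geometry.ComplexHyperbolic.BallModel (U21 x₀)
open Literature.NumberTheory.GelbartRogawski1991.OscillatorTripleDictionary (rhoTriple)
open Summit.HodgeConjecture.CorCM.Lines.A3Liu413 (datum413)
open Summit.HodgeConjecture.HodgeConjecture.Cruxes.H413.CohFormsCarriers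
open Literature.NumberTheory.Automorphic.UnitaryGroup
open Literature.NumberTheory.Automorphic.UnitaryGroup.CotangentForms (toQuotFun cmArchSection cmCompactFactor)
open Summit.HodgeConjecture.HodgeConjecture.Cruxes.H413.F0P3SpectralJunction
open Summit.HodgeConjecture.HodgeConjecture.Cruxes.H413.F0P3HilbertProjection
open Summit.HodgeConjecture.HodgeConjecture.Cruxes.H413.SpectrumJunction (continuous_toQuotFun compactSpace_automorphicQuotient_adelicDatum)
open Literature.NumberTheory.Automorphic.UnitaryGroup.CotangentForms (holCotForms conjFun)
open Summit.HodgeConjecture.HodgeConjecture.Cruxes.H413.F0P3StubS5Fold (two_le_finrank_maximalRealSubfield exists_ne_zero_containsForm_of_classes)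
open Summit.HodgeConjecture.HodgeConjecture.Cruxes.H413.F0P3ThreadLetters3Defs

/-! ## §1 The S5 fold from E2′₃ (by name) + the detection letters + continuity — ★ `stubS5_of` twin -/

set_option synthInstance.maxHeartbeats 400000 in
set_option maxHeartbeats 8000000 in
/-- **THE S5 FOLD, TWO-COMPACT-PLACE TWIN** — ★ `F0P3StubS5Fold.stubS5_of` with `hE2' : HodgeTypeRigid₃`, `h3` from `h6` beside `h2`, passed at the one application of E2′; proof otherwise
VERBATIM (two non-zero equivariant maps of the two Hodge types, ONE automorphic measure, Schur at `ω_V(t)`, detection of a `(1,0)`- and a `(0,1)`-type `P`, `P′` with finite component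
`ω_V(t)`, then E2′).  HC_CM is proved only modulo the printed citations until rung 0 closes. [cite: Rogawski1990, Thm. 13.3.6 (c); §15.3 ¶1; §12.3 p. 174; Thm. 14.6.4; Thm. 13.3.5]
[cite: BorelJacquet1979, §4.6] [cite: Liu2021, proof of Prop. 4.13, l. 2140–2146; Lem. D.2 (2)] -/
theorem stubS5_of₃ (hE2' : HodgeTypeRigid₃)
    (hTPhol : ∀ (L : Type) [Field L] [NumberField L] [IsCMField L] (ι : L →+* ℂ) (H : Matrix (Fin 3) (Fin 3) L) (T : GL (Fin 3) ℂ)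
      (hT : (T : Matrix (Fin 3) (Fin 3) ℂ)ᴴ * H.map ι * (T : Matrix (Fin 3) (Fin 3) ℂ) = Literature.Geometry.ComplexHyperbolic.BallModel.J),
      (∀ τ' : L →+* ℂ, InfinitePlace.mk τ' ≠ InfinitePlace.mk ι → (H.map τ').PosDef) →
      2 ≤ Module.finrank ℚ ↥(maximalRealSubfield L) →
      ∀ (μ : Measure (adelicGroupData (↥(maximalRealSubfield L)) L (IsCMField.complexConj L) 3 H).automorphicQuotient)
        [(adelicGroupData (↥(maximalRealSubfield L)) L (IsCMField.complexConj L) 3 H).IsAutomorphicMeasure μ]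
        (P : DiscreteAutomorphicRep (adelicGroupData (↥(maximalRealSubfield L)) L (IsCMField.complexConj L) 3 H) μ)
        (Φ : (adelicGroupData (↥(maximalRealSubfield L)) L (IsCMField.complexConj L) 3 H).Adelic → (Fin 2 → ℂ)),
        Φ ∈ CotangentForms.holCotForms (↥(maximalRealSubfield L)) L (IsCMField.complexConj L) 3 H (cmArchSection L ι H T hT)
          (cmCompactFactor L ι H T hT) →
        ∀ (h : ∀ j : Fin 2, MemLp (toQuotFun (adelicGroupData (↥(maximalRealSubfield L)) L (IsCMField.complexConj L) 3 H)
          fun x => Φ x j) 2 μ),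
        (∃ (j : Fin 2), ∃ u ∈ P.space,
          ⟪(u : (adelicGroupData (↥(maximalRealSubfield L)) L (IsCMField.complexConj L) 3 H).L2 μ), (h j).toLp⟫_ℂ ≠ 0) →
        P.IsHolCotangentAt (cmArchSection L ι H T hT) (cmCompactFactor L ι H T hT))
    (hTPantihol : ∀ (L : Type) [Field L] [NumberField L] [IsCMField L] (ι : L →+* ℂ) (H : Matrix (Fin 3) (Fin 3) L) (T : GL (Fin 3) ℂ)
      (hT : (T : Matrix (Fin 3) (Fin 3) ℂ)ᴴ * H.map ι * (T : Matrix (Fin 3) (Fin 3) ℂ) = Literature.Geometry.ComplexHyperbolic.BallModel.J),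
      (∀ τ' : L →+* ℂ, InfinitePlace.mk τ' ≠ InfinitePlace.mk ι → (H.map τ').PosDef) →
      2 ≤ Module.finrank ℚ ↥(maximalRealSubfield L) →
      ∀ (μ : Measure (adelicGroupData (↥(maximalRealSubfield L)) L (IsCMField.complexConj L) 3 H).automorphicQuotient)
        [(adelicGroupData (↥(maximalRealSubfield L)) L (IsCMField.complexConj L) 3 H).IsAutomorphicMeasure μ]
        (P : DiscreteAutomorphicRep (adelicGroupData (↥(maximalRealSubfield L)) L (IsCMField.complexConj L) 3 H) μ)
        (Φ : (adelicGroupData (↥(maximalRealSubfield L)) L (IsCMField.complexConj L) 3 H).Adelic → (Fin 2 → ℂ)),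
        Φ ∈ (CotangentForms.holCotForms (↥(maximalRealSubfield L)) L (IsCMField.complexConj L) 3 H (cmArchSection L ι H T hT)
          (cmCompactFactor L ι H T hT)).map (CotangentForms.conjFun (↥(maximalRealSubfield L)) L (IsCMField.complexConj L) 3 H) →
        ∀ (h : ∀ j : Fin 2, MemLp (toQuotFun (adelicGroupData (↥(maximalRealSubfield L)) L (IsCMField.complexConj L) 3 H)
          fun x => Φ x j) 2 μ),
        (∃ (j : Fin 2), ∃ u ∈ P.space,
          ⟪(u : (adelicGroupData (↥(maximalRealSubfield L)) L (IsCMField.complexConj L) 3 H).L2 μ), (h j).toLp⟫_ℂ ≠ 0) →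
        P.IsAntiholCotangentAt (cmArchSection L ι H T hT) (cmCompactFactor L ι H T hT))
    (hcont : ∀ (F : HodgeCM.CMField) {ι₁ : F →+* ℂ} (V : HodgeCM.HermSpace3 F ι₁), 4 ≤ Module.finrank ℚ F →
      ∀ f ∈ cohForms (archFactorOf F V), ∀ j : Fin 2, Continuous fun x => f x j) :
    ∀ (hDel : Literature.AlgebraicGeometry.ShimuraVarieties.UnitaryCanonicalModel.canonicalModel_exists_printed)
      (F : HodgeCM.CMField) [IsGalois ℚ F] (h6 : 6 ≤ Module.finrank ℚ F) {ι₁ : F →+* ℂ} (V : HodgeCM.HermSpace3 F ι₁) (a₀ : RealScalar F)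
      (Φ : CMType F) (hΦ : ι₁ ∈ Φ.1) (i : (I V (repAt a₀) (muLiu ι₁ GramClass.rep))),
      3 ≤ (datum413 hDel F V a₀ Φ i).n → ∀ t : (datum413 hDel F V a₀ Φ i).AdmTriple,
        (∀ ψ : (datum413 hDel F V a₀ Φ i).omegaAt t →ₗ[ℂ] ((adelicDatum F V).Adelic → (Fin 2 → ℂ)),
            (∀ (g : ↥(HodgeCM.HermSpace3.adelicFin V)) (w : (datum413 hDel F V a₀ Φ i).omegaAt t),
                ψ ((datum413 hDel F V a₀ Φ i).rhoAt t g w) = rightRep F V g (ψ w)) →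
              (∀ w, ψ w ∈ holCotForms (archFactorOf F V)) → ψ = 0) ∨
        (∀ ψ : (datum413 hDel F V a₀ Φ i).omegaAt t →ₗ[ℂ] ((adelicDatum F V).Adelic → (Fin 2 → ℂ)),
            (∀ (g : ↥(HodgeCM.HermSpace3.adelicFin V)) (w : (datum413 hDel F V a₀ Φ i).omegaAt t),
                ψ ((datum413 hDel F V a₀ Φ i).rhoAt t g w) = rightRep F V g (ψ w)) →
              (∀ w, ψ w ∈ (holCotForms (archFactorOf F V)).map (conjFun F V)) → ψ = 0) := by
  intro hDel F _ h6 ι₁ V a₀ Φ hΦ i hn t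
  by_contra hcon
  push Not at hcon
  obtain ⟨⟨ψ, hψe, hψv, hψ0⟩, ⟨ψ', hψ'e, hψ'v, hψ'0⟩⟩ := hcon
  have h4 : 4 ≤ Module.finrank ℚ F := le_trans (by norm_num) h6
  have h2 := two_le_finrank_maximalRealSubfield F h6
  have h3 := Summit.HodgeConjecture.HodgeConjecture.R90.three_le_finrank_maximalRealSubfield_of_six_le (HodgeCM.CMField.K F) h6
  -- ONE automorphic measure for both halves
  obtain ⟨μ, hμ⟩ := exists_isAutomorphicMeasure (V := V) h4
  haveI := hμ
  -- `ω_V(t)` is non-zero (as `ψ ≠ 0`), hence irreducible, and smooth: ★ `H411_proof` ([Liu2021, Def. 4.11] as printed at the pin)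
  obtain ⟨w₁, hw₁⟩ : ∃ w, ψ w ≠ 0 := by
    by_contra h
    push Not at h
    exact hψ0 (LinearMap.ext h)
  haveI : Nontrivial ((datum413 hDel F V a₀ Φ i).omegaAt t) :=
    ⟨⟨w₁, 0, fun h => hw₁ (by rw [h, map_zero])⟩⟩
  have hadj := Summit.HodgeConjecture.HodgeConjecture.Theorems.H411_proof hDel F h6 V (repAt a₀ (Sigma.fst i)) Φ hΦ
    t.1.μ t.1.isConjugateSymplectic t.2.1 t.1.ε t.1.χ
  have hirr : ((datum413 hDel F V a₀ Φ i).rhoAt t).IsIrreducible := isIrreducible_of_nontrivial hadj.1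
  have hsm : ((datum413 hDel F V a₀ Φ i).rhoAt t).IsSmooth := fun v => by
    obtain ⟨S, hS, hfix⟩ := hadj.2.1 v
    exact Representation.isSmoothVector_of_le _ hS fun k hk => hfix k hk
  -- the junction J1′, twice (same `μ`)
  obtain ⟨P, w, j, h, hu, hfin⟩ := exists_discreteAutomorphicRep_of_equivariant_cohForms h4 μ (archFactorOf F V)
    (hcont F V h4) ((datum413 hDel F V a₀ Φ i).rhoAt t) hirr ψ hψe
    (fun w => show ψ w ∈ holCotForms (archFactorOf F V) ⊔ _ from Submodule.mem_sup_left (hψv w)) hψ0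
  obtain ⟨P', w', j', h', hu', hfin'⟩ := exists_discreteAutomorphicRep_of_equivariant_cohForms h4 μ (archFactorOf F V)
    (hcont F V h4) ((datum413 hDel F V a₀ Φ i).rhoAt t) hirr ψ' hψ'e
    (fun w => show ψ' w ∈ _ ⊔ (holCotForms (archFactorOf F V)).map (conjFun F V) from Submodule.mem_sup_right (hψ'v w)) hψ'0
  -- all coordinates of cotangent forms are `L²` (continuity on the compact quotient)
  haveI := compactSpace_automorphicQuotient_adelicDatum F V h4
  have hmem : ∀ f ∈ cohForms (archFactorOf F V), ∀ j : Fin 2, MemLp (toQuotFun (adelicDatum F V) fun x => f x j) 2 μ :=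
    fun f hf j => memLp_of_continuous (continuous_toQuotFun (cohForms_left_invariant_apply (archFactorOf F V) hf j) (hcont F V h4 f hf j))
  -- the analytic letter TP: the two discrete representations have the two Hodge types
  have hP : P.IsHolCotangentAt (archFactorOf F V).ιinf (archFactorOf F V).Kc :=
    hTPhol (HodgeCM.CMField.K F) ι₁ (HodgeCM.HermSpace3.Hm V) V.sylvesterFrame (HodgeCM.Model.sylvesterFrame_J V) V.posDef_of_ne h2 μ
      P (ψ w) (hψv w) (hmem (ψ w) (Submodule.mem_sup_left (hψv w))) ⟨j, hu⟩
  have hP' : P'.IsAntiholCotangentAt (archFactorOf F V).ιinf (archFactorOf F V).Kc :=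
    hTPantihol (HodgeCM.CMField.K F) ι₁ (HodgeCM.HermSpace3.Hm V) V.sylvesterFrame (HodgeCM.Model.sylvesterFrame_J V) V.posDef_of_ne
      h2 μ P' (ψ' w') (hψ'v w') (hmem (ψ' w') (Submodule.mem_sup_right (hψ'v w'))) ⟨j', hu'⟩
  -- the engine letter E2′: impossible
  exact hE2' (HodgeCM.CMField.K F) ι₁ (HodgeCM.HermSpace3.Hm V) V.sylvesterFrame (HodgeCM.Model.sylvesterFrame_J V) V.posDef_of_ne h2 h3 μ
    ((datum413 hDel F V a₀ Φ i).omegaAt t) ((datum413 hDel F V a₀ Φ i).rhoAt t) hirr hsm P P' hP hP' hfin hfin'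

/-! ## §2 The TP⁺ form — ★ `stubS5_of_spectralProjection` twin -/

set_option synthInstance.maxHeartbeats 400000 in
set_option maxHeartbeats 8000000 in
/-- **THE S5 FOLD FROM THE REPRESENTABLE LETTER TP⁺, TWO-COMPACT-PLACE TWIN** — ★ `stubS5_of_spectralProjection` with `hE2' : HodgeTypeRigid₃`; the TP⁺ hypotheses and the five-line
reduction to the detection form are VERBATIM (★ `exists_ne_zero_containsForm_of_classes` by name).  HC_CM is proved only modulo the printed citations until rung 0 closes.
[cite: Rogawski1990, Thm. 13.3.6 (c); §15.3 ¶1; §12.3 p. 174; Thm. 14.6.4; Thm. 13.3.5] [cite: BorelJacquet1979, §4.6] [cite: Liu2021, proof of Prop. 4.13, l. 2140–2146; Lem. D.2 (2)] -/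
theorem stubS5_of_spectralProjection₃ (hE2' : HodgeTypeRigid₃)
    (hTPhol : ∀ (L : Type) [Field L] [NumberField L] [IsCMField L] (ι : L →+* ℂ) (H : Matrix (Fin 3) (Fin 3) L) (T : GL (Fin 3) ℂ)
      (hT : (T : Matrix (Fin 3) (Fin 3) ℂ)ᴴ * H.map ι * (T : Matrix (Fin 3) (Fin 3) ℂ) = Literature.Geometry.ComplexHyperbolic.BallModel.J),
      (∀ τ' : L →+* ℂ, InfinitePlace.mk τ' ≠ InfinitePlace.mk ι → (H.map τ').PosDef) →
      2 ≤ Module.finrank ℚ ↥(maximalRealSubfield L) →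
      ∀ (μ : Measure (adelicGroupData (↥(maximalRealSubfield L)) L (IsCMField.complexConj L) 3 H).automorphicQuotient)
        [(adelicGroupData (↥(maximalRealSubfield L)) L (IsCMField.complexConj L) 3 H).IsAutomorphicMeasure μ]
        (P : DiscreteAutomorphicRep (adelicGroupData (↥(maximalRealSubfield L)) L (IsCMField.complexConj L) 3 H) μ)
        (Φ : (adelicGroupData (↥(maximalRealSubfield L)) L (IsCMField.complexConj L) 3 H).Adelic → (Fin 2 → ℂ)),
        Φ ∈ CotangentForms.holCotForms (↥(maximalRealSubfield L)) L (IsCMField.complexConj L) 3 H (cmArchSection L ι H T hT)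
          (cmCompactFactor L ι H T hT) →
        ∀ (h : ∀ j : Fin 2, MemLp (toQuotFun (adelicGroupData (↥(maximalRealSubfield L)) L (IsCMField.complexConj L) 3 H)
          fun x => Φ x j) 2 μ),
        ∃ Φ' ∈ CotangentForms.holCotForms (↥(maximalRealSubfield L)) L (IsCMField.complexConj L) 3 H (cmArchSection L ι H T hT)
          (cmCompactFactor L ι H T hT),
        ∃ h' : (∀ j : Fin 2, MemLp (toQuotFun (adelicGroupData (↥(maximalRealSubfield L)) L (IsCMField.complexConj L) 3 H)
          fun x => Φ' x j) 2 μ),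
        ∀ j : Fin 2, P.space.toSubmodule.starProjection ((h j).toLp _) =
          ((h' j).toLp _ : (adelicGroupData (↥(maximalRealSubfield L)) L (IsCMField.complexConj L) 3 H).L2 μ))
    (hTPantihol : ∀ (L : Type) [Field L] [NumberField L] [IsCMField L] (ι : L →+* ℂ) (H : Matrix (Fin 3) (Fin 3) L) (T : GL (Fin 3) ℂ)
      (hT : (T : Matrix (Fin 3) (Fin 3) ℂ)ᴴ * H.map ι * (T : Matrix (Fin 3) (Fin 3) ℂ) = Literature.Geometry.ComplexHyperbolic.BallModel.J),
      (∀ τ' : L →+* ℂ, InfinitePlace.mk τ' ≠ InfinitePlace.mk ι → (H.map τ').PosDef) →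
      2 ≤ Module.finrank ℚ ↥(maximalRealSubfield L) →
      ∀ (μ : Measure (adelicGroupData (↥(maximalRealSubfield L)) L (IsCMField.complexConj L) 3 H).automorphicQuotient)
        [(adelicGroupData (↥(maximalRealSubfield L)) L (IsCMField.complexConj L) 3 H).IsAutomorphicMeasure μ]
        (P : DiscreteAutomorphicRep (adelicGroupData (↥(maximalRealSubfield L)) L (IsCMField.complexConj L) 3 H) μ)
        (Φ : (adelicGroupData (↥(maximalRealSubfield L)) L (IsCMField.complexConj L) 3 H).Adelic → (Fin 2 → ℂ)),
        Φ ∈ (CotangentForms.holCotForms (↥(maximalRealSubfield L)) L (IsCMField.complexConj L) 3 H (cmArchSection L ι H T hT)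
          (cmCompactFactor L ι H T hT)).map (CotangentForms.conjFun (↥(maximalRealSubfield L)) L (IsCMField.complexConj L) 3 H) →
        ∀ (h : ∀ j : Fin 2, MemLp (toQuotFun (adelicGroupData (↥(maximalRealSubfield L)) L (IsCMField.complexConj L) 3 H)
          fun x => Φ x j) 2 μ),
        ∃ Φ' ∈ (CotangentForms.holCotForms (↥(maximalRealSubfield L)) L (IsCMField.complexConj L) 3 H (cmArchSection L ι H T hT)
          (cmCompactFactor L ι H T hT)).map (CotangentForms.conjFun (↥(maximalRealSubfield L)) L (IsCMField.complexConj L) 3 H),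
        ∃ h' : (∀ j : Fin 2, MemLp (toQuotFun (adelicGroupData (↥(maximalRealSubfield L)) L (IsCMField.complexConj L) 3 H)
          fun x => Φ' x j) 2 μ),
        ∀ j : Fin 2, P.space.toSubmodule.starProjection ((h j).toLp _) =
          ((h' j).toLp _ : (adelicGroupData (↥(maximalRealSubfield L)) L (IsCMField.complexConj L) 3 H).L2 μ))
    (hcont : ∀ (F : HodgeCM.CMField) {ι₁ : F →+* ℂ} (V : HodgeCM.HermSpace3 F ι₁), 4 ≤ Module.finrank ℚ F →
      ∀ f ∈ cohForms (archFactorOf F V), ∀ j : Fin 2, Continuous fun x => f x j) :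
    ∀ (hDel : Literature.AlgebraicGeometry.ShimuraVarieties.UnitaryCanonicalModel.canonicalModel_exists_printed)
      (F : HodgeCM.CMField) [IsGalois ℚ F] (h6 : 6 ≤ Module.finrank ℚ F) {ι₁ : F →+* ℂ} (V : HodgeCM.HermSpace3 F ι₁) (a₀ : RealScalar F)
      (Φ : CMType F) (hΦ : ι₁ ∈ Φ.1) (i : (I V (repAt a₀) (muLiu ι₁ GramClass.rep))),
      3 ≤ (datum413 hDel F V a₀ Φ i).n → ∀ t : (datum413 hDel F V a₀ Φ i).AdmTriple,
        (∀ ψ : (datum413 hDel F V a₀ Φ i).omegaAt t →ₗ[ℂ] ((adelicDatum F V).Adelic → (Fin 2 → ℂ)),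
            (∀ (g : ↥(HodgeCM.HermSpace3.adelicFin V)) (w : (datum413 hDel F V a₀ Φ i).omegaAt t),
                ψ ((datum413 hDel F V a₀ Φ i).rhoAt t g w) = rightRep F V g (ψ w)) →
              (∀ w, ψ w ∈ holCotForms (archFactorOf F V)) → ψ = 0) ∨
        (∀ ψ : (datum413 hDel F V a₀ Φ i).omegaAt t →ₗ[ℂ] ((adelicDatum F V).Adelic → (Fin 2 → ℂ)),
            (∀ (g : ↥(HodgeCM.HermSpace3.adelicFin V)) (w : (datum413 hDel F V a₀ Φ i).omegaAt t),
                ψ ((datum413 hDel F V a₀ Φ i).rhoAt t g w) = rightRep F V g (ψ w)) →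
              (∀ w, ψ w ∈ (holCotForms (archFactorOf F V)).map (conjFun F V)) → ψ = 0) := by
  refine stubS5_of₃ hE2' ?_ ?_ hcont
  · intro L _ _ _ ι H T hT hdef h2 μ _ P Φ hΦ h hu
    obtain ⟨j, hu⟩ := hu
    obtain ⟨Φ', hΦ', h', heq⟩ := hTPhol L ι H T hT hdef h2 μ P Φ hΦ h
    refine exists_ne_zero_containsForm_of_classes P hΦ' h' (fun j' => ?_) ⟨j, ?_⟩
    · rw [← heq j']
      exact Submodule.starProjection_apply_mem _ _
    · rw [← heq j, Submodule.starProjection_apply]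
      exact Subtype.coe_ne_coe.mpr (orthogonalProjectionOnto_ne_zero P.space hu)
  · intro L _ _ _ ι H T hT hdef h2 μ _ P Φ hΦ h hu
    obtain ⟨j, hu⟩ := hu
    obtain ⟨Φ', hΦ', h', heq⟩ := hTPantihol L ι H T hT hdef h2 μ P Φ hΦ h
    refine exists_ne_zero_containsForm_of_classes P hΦ' h' (fun j' => ?_) ⟨j, ?_⟩
    · rw [← heq j']
      exact Submodule.starProjection_apply_mem _ _
    · rw [← heq j, Submodule.starProjection_apply]
      exact Subtype.coe_ne_coe.mpr (orthogonalProjectionOnto_ne_zero P.space hu)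

/-! ## §3 By name over the ★ letters (D)hol ∕ (D)antihol — ★ `stubS5_holds` twin -/

set_option synthInstance.maxHeartbeats 400000 in
set_option maxHeartbeats 8000000 in
/-- **STUB S5 — HODGE-TYPE EXCLUSION AT THE PIN — modulo E2′₃ (`HodgeTypeRigid₃`, by name) and the ★ letters (D)hol, (D)antihol by name** (★ `F0P3StubS5Fold.stubS5_holds` twin:
`stubS5_of_spectralProjection₃` fed ★ `holCotFormSpectralProjection` ∕ ★ `antiholCotFormSpectralProjection` by δ and ★ `CohFormsL2.continuous_apply_of_mem_cohForms`).  HC_CM is proved only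
modulo the printed citations until rung 0 closes. [cite: Rogawski1990, Thm. 13.3.6 (c); §15.3 ¶1; §12.3 p. 174; Thm. 14.6.4; Thm. 13.3.5] [cite: BorelJacquet1979, §4.6] [cite: Borel1997, Thm. 2.13 and §8.4]
[cite: Liu2021, proof of Prop. 4.13, l. 2140–2146; Lem. D.2 (2)] -/
theorem stubS5_holds₃ (hE2' : HodgeTypeRigid₃)
    (hDh : Literature.NumberTheory.Automorphic.UnitaryGroup.CotangentForms.holCotFormSpectralProjection)
    (hDa : Literature.NumberTheory.Automorphic.UnitaryGroup.CotangentForms.antiholCotFormSpectralProjection) :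
    ∀ (hDel : Literature.AlgebraicGeometry.ShimuraVarieties.UnitaryCanonicalModel.canonicalModel_exists_printed)
      (F : HodgeCM.CMField) [IsGalois ℚ F] (h6 : 6 ≤ Module.finrank ℚ F) {ι₁ : F →+* ℂ} (V : HodgeCM.HermSpace3 F ι₁) (a₀ : RealScalar F)
      (Φ : CMType F) (hΦ : ι₁ ∈ Φ.1) (i : (I V (repAt a₀) (muLiu ι₁ GramClass.rep))),
      3 ≤ (datum413 hDel F V a₀ Φ i).n → ∀ t : (datum413 hDel F V a₀ Φ i).AdmTriple,
        (∀ ψ : (datum413 hDel F V a₀ Φ i).omegaAt t →ₗ[ℂ] ((adelicDatum F V).Adelic → (Fin 2 → ℂ)),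
            (∀ (g : ↥(HodgeCM.HermSpace3.adelicFin V)) (w : (datum413 hDel F V a₀ Φ i).omegaAt t),
                ψ ((datum413 hDel F V a₀ Φ i).rhoAt t g w) = rightRep F V g (ψ w)) →
              (∀ w, ψ w ∈ holCotForms (archFactorOf F V)) → ψ = 0) ∨
        (∀ ψ : (datum413 hDel F V a₀ Φ i).omegaAt t →ₗ[ℂ] ((adelicDatum F V).Adelic → (Fin 2 → ℂ)),
            (∀ (g : ↥(HodgeCM.HermSpace3.adelicFin V)) (w : (datum413 hDel F V a₀ Φ i).omegaAt t),
                ψ ((datum413 hDel F V a₀ Φ i).rhoAt t g w) = rightRep F V g (ψ w)) →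
              (∀ w, ψ w ∈ (holCotForms (archFactorOf F V)).map (conjFun F V)) → ψ = 0) :=
  stubS5_of_spectralProjection₃ hE2' hDh hDa Summit.HodgeConjecture.HodgeConjecture.Cruxes.H413.CohFormsL2.continuous_apply_of_mem_cohForms

end Summit.HodgeConjecture.HodgeConjecture.Cruxes.H413.F0P3StubS5Fold3

end
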